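/-
Origin: expansion seat `planner-pub-hodgecm-pv10-0`, handover 2026-08-18 (`HOME/pub-hodgecm-pv10/lean/Pv10/RealPlaceSigns.lean`, md5 6ad28c4d, 136 lines);
landed by the gen-6 packager in gate run 22 as `HodgeCM/PerL34/RealPlaceSigns.lean` (import ^import Pv[0-9]+\.→import HodgeCM.PerL34. ×1).
-/
/-
Origin: planner-pub-hodgecm-pv10-0 (unit pub-hodgecm-pv10), HodgeCM publication cell, 2026-08-18.
Node N15 (PerL v5 §3.2, tex ll. 305–308): "unitary Hecke characters of `L` with prescribed components
`(z/|z|)^{m_b}` at the complex places and prescribed restriction `ε^m_{L/L₀}` to `𝔸^×_{L₀}`, all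
`m_b ≡ m mod 2`, exist: the two prescriptions agree on `L^×_∞ ∩ 𝔸^×_{L₀} = L^×_{0,∞}` …" — the LOCAL
computation at a real place of `L₀` under a complex place of `L`, KERNEL.
-/
import Summits.HodgeConjecture.HodgeCM.PerL34.InfinityType

/-!
# Signs at the real places (node N15, "the two prescriptions agree on `L^×_{0,∞}`")

At a real place `v` of `L₀` lying under a complex place `b` of the CM field `L` one has
`L_{0,v}^× = ℝˣ ⊂ ℂˣ = L_b^×`.  Prescription 1 is `z ↦ (z/|z|)^{m_b}` (`Complex.unitPart ^ m_b`);
prescription 2 is `ε_{L/L₀,v}^m`, where the local component `ε_{L/L₀,v}` of the quadratic idele class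
character is — by local reciprocity for `ℂ/ℝ` (PRINT) — the nontrivial character of `ℝˣ` trivial on the
norm group `N_{ℂ/ℝ}(ℂˣ) = ℝ_{>0}`.  Kernel content:

* `Complex.exists_normSq_eq_iff`: `N_{ℂ/ℝ}(ℂˣ) = ℝ_{>0}`;
* `Complex.eq_unitPart_of_trivial_on_pos`: a character of `ℝˣ` trivial on `ℝ_{>0}` is trivial or
  `x ↦ x/|x|` — so `ε_{L/L₀,v} = unitPart|_{ℝˣ}`;
* `Complex.unitPart_ofRealUnits_sq`: `(x/|x|)² = 1` on `ℝˣ`, whence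
* `Complex.unitPart_ofRealUnits_zpow_congr`: `(x/|x|)^{m_b} = (x/|x|)^m` on `ℝˣ` when `m_b ≡ m (mod 2)`
  — the two prescriptions AGREE on `L^×_{0,v}`; and `…_iff`: they agree only if `m_b ≡ m (mod 2)`.
-/

set_option autoImplicit false

/-- In a group, an element of square `1` has equal powers at exponents congruent mod `2`. -/
theorem zpow_eq_zpow_of_sq_eq_one_of_modEq {G : Type*} [Group G] {g : G} (hg : g ^ 2 = 1)
    {a b : ℤ} (h : a ≡ b [ZMOD 2]) : g ^ a = g ^ b := by
  obtain ⟨k, hk⟩ := (Int.ModEq.dvd h : (2 : ℤ) ∣ b - a)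
  have hb : b = a + 2 * k := by omega
  have h2 : g ^ (2 : ℤ) = 1 := by rw [zpow_two, ← pow_two, hg]
  rw [hb, zpow_add, zpow_mul, h2, one_zpow, mul_one]

namespace Complex

/-- `ℝˣ → ℂˣ`. -/
def ofRealUnits : ℝˣ →* ℂˣ := Units.map (Complex.ofRealHom : ℝ →+* ℂ).toMonoidHom

/-- (Ported verbatim from the HodgeCMPerL package; no docstring in the source.) -/
@[simp] theorem coe_ofRealUnits (x : ℝˣ) : ((ofRealUnits x : ℂˣ) : ℂ) = ((x : ℝ) : ℂ) := rfl

/-- (Ported verbatim from the HodgeCMPerL package; no docstring in the source.) -/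
theorem coe_unitPart_ofRealUnits (x : ℝˣ) :
    (unitPart (ofRealUnits x) : ℂ) = (((x : ℝ) / |(x : ℝ)| : ℝ) : ℂ) := by
  rw [coe_unitPart, coe_ofRealUnits, Complex.norm_real, Real.norm_eq_abs, Complex.ofReal_div]

/-- `x/|x| = 1` for `x > 0`. -/
theorem unitPart_ofRealUnits_of_pos (x : ℝˣ) (hx : 0 < (x : ℝ)) :
    unitPart (ofRealUnits x) = 1 := by
  apply Circle.ext
  rw [coe_unitPart_ofRealUnits, abs_of_pos hx, div_self x.ne_zero, Complex.ofReal_one,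
    Circle.coe_one]

/-- `x/|x| = -1` for `x < 0`. -/
theorem coe_unitPart_ofRealUnits_of_neg (x : ℝˣ) (hx : (x : ℝ) < 0) :
    (unitPart (ofRealUnits x) : ℂ) = -1 := by
  rw [coe_unitPart_ofRealUnits, abs_of_neg hx, div_neg, div_self x.ne_zero, Complex.ofReal_neg,
    Complex.ofReal_one]

/-- `(x/|x|)² = 1` on `ℝˣ`. -/
theorem unitPart_ofRealUnits_sq (x : ℝˣ) : unitPart (ofRealUnits x) ^ 2 = 1 := by
  apply Circle.ext
  rw [Circle.coe_pow, Circle.coe_one]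
  rcases lt_or_gt_of_ne x.ne_zero with h | h
  · rw [coe_unitPart_ofRealUnits_of_neg x h]; norm_num
  · rw [unitPart_ofRealUnits_of_pos x h, Circle.coe_one, one_pow]

/-- **PerL l. 307 (agreement on `L^×_{0,v}`).**  On `ℝˣ ⊂ ℂˣ` the characters `(z/|z|)^{m_b}` and
`(x/|x|)^m` coincide as soon as `m_b ≡ m (mod 2)`. -/
theorem unitPart_ofRealUnits_zpow_congr (x : ℝˣ) {mb m : ℤ} (h : mb ≡ m [ZMOD 2]) :
    unitPart (ofRealUnits x) ^ mb = unitPart (ofRealUnits x) ^ m :=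
  zpow_eq_zpow_of_sq_eq_one_of_modEq (unitPart_ofRealUnits_sq x) h

/-- … and ONLY then (test at `x = -1`). -/
theorem unitPart_ofRealUnits_zpow_congr_iff {mb m : ℤ} :
    (∀ x : ℝˣ, unitPart (ofRealUnits x) ^ mb = unitPart (ofRealUnits x) ^ m) ↔ mb ≡ m [ZMOD 2] := by
  refine ⟨fun h => ?_, fun h x => unitPart_ofRealUnits_zpow_congr x h⟩
  -- `u := (-1)/|-1| = -1` has order `2` in `Circle`, and `u ^ mb = u ^ m`
  have hneg : (((-1 : ℝˣ) : ℝ)) < 0 := by rw [Units.val_neg, Units.val_one]; norm_num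
  have hu1 : unitPart (ofRealUnits (-1)) ≠ 1 := by
    intro h1
    have := congrArg (fun z : Circle => (z : ℂ)) h1
    simp only [coe_unitPart_ofRealUnits_of_neg (-1) hneg, Circle.coe_one] at this
    norm_num at this
  have hord : orderOf (unitPart (ofRealUnits (-1))) = 2 :=
    orderOf_eq_prime (unitPart_ofRealUnits_sq (-1)) hu1
  have := (zpow_eq_zpow_iff_modEq (x := unitPart (ofRealUnits (-1)))).mp (h (-1))
  rwa [hord] at this

/-- **`N_{ℂ/ℝ}(ℂˣ) = ℝ_{>0}`.**  A real number is the norm `z \bar z` of a nonzero complex number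
iff it is positive. -/
theorem exists_normSq_eq_iff (x : ℝ) : (∃ z : ℂ, z ≠ 0 ∧ Complex.normSq z = x) ↔ 0 < x := by
  constructor
  · rintro ⟨z, hz, rfl⟩
    exact Complex.normSq_pos.mpr hz
  · intro hx
    refine ⟨(Real.sqrt x : ℂ), ?_, ?_⟩
    · exact_mod_cast (Real.sqrt_pos.mpr hx).ne'
    · rw [Complex.normSq_ofReal, Real.mul_self_sqrt hx.le]

/-- **Local reciprocity dictionary at a real place (`ε_{L/L₀,v} = x/|x|`).**  A character of `ℝˣ`
trivial on the norm group `ℝ_{>0}` is either trivial or `x ↦ x/|x|`; the local component of the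
quadratic character `ε_{L/L₀}` at a real place under a complex one is the NONTRIVIAL such character
(local class field theory for `ℂ/ℝ`, PRINT), hence equals `unitPart ∘ ofRealUnits`. -/
theorem eq_unitPart_of_trivial_on_pos (χ : ℝˣ →* Circle)
    (hpos : ∀ x : ℝˣ, 0 < (x : ℝ) → χ x = 1) :
    χ = 1 ∨ χ = unitPart.comp ofRealUnits := by
  have key : ∀ x : ℝˣ, (x : ℝ) < 0 → χ x = χ (-1) := by
    intro x hx
    have hnx : 0 < ((-x : ℝˣ) : ℝ) := by rw [Units.val_neg]; exact neg_pos.mpr hx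
    calc χ x = χ (-1 * -x) := by rw [neg_one_mul, neg_neg]
      _ = χ (-1) := by rw [map_mul, hpos (-x) hnx, mul_one]
  have hsq : (χ (-1) : ℂ) * χ (-1) = 1 := by
    rw [← Circle.coe_mul, ← map_mul, neg_one_mul, neg_neg, map_one, Circle.coe_one]
  rcases mul_self_eq_one_iff.mp hsq with h1 | h1
  · left
    refine MonoidHom.ext fun x => ?_
    rcases lt_or_gt_of_ne x.ne_zero with hx | hx
    · rw [key x hx, MonoidHom.one_apply]
      exact Circle.ext (by rw [h1, Circle.coe_one])
    · rw [hpos x hx, MonoidHom.one_apply]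
  · right
    refine MonoidHom.ext fun x => ?_
    rw [MonoidHom.comp_apply]
    rcases lt_or_gt_of_ne x.ne_zero with hx | hx
    · exact Circle.ext (by rw [key x hx, h1, coe_unitPart_ofRealUnits_of_neg x hx])
    · rw [hpos x hx, unitPart_ofRealUnits_of_pos x hx]

/-- The nontrivial branch, as used: a NONTRIVIAL character of `ℝˣ` trivial on `ℝ_{>0}` is `x/|x|`. -/
theorem eq_unitPart_of_trivial_on_pos_of_ne_one (χ : ℝˣ →* Circle)
    (hpos : ∀ x : ℝˣ, 0 < (x : ℝ) → χ x = 1) (hne : χ ≠ 1) :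
    χ = unitPart.comp ofRealUnits :=
  (eq_unitPart_of_trivial_on_pos χ hpos).resolve_left hne

end Complex
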